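import Literature.Probability.LatticeModels.SixVertexSpectralFTransform
import Mathlib.Analysis.SpecialFunctions.Trigonometric.Bounds

/-!
# Six-vertex spectral measures: eq. (last_identity) ⇒ eq. (identifying Delta I)
# (DKLM 2026, Part II, proof of Theorem 46)

H. Duminil-Copin, K. K. Kozlowski, P. Lammers, I. Manolescu, *Gaussian free field convergence of
the six-vertex model with `-1 ≤ Δ ≤ -1/2`*, arXiv:2603.06268 (2026) [DKLM2026SixVertexGFF]
(`paper:arxiv-2603.06268`, chunks p0029–p0030):

> Set `u₁ = -ne₁`, `u₁' = (0,0)`, `u₂ = se₁`, and `u₂' = u₂ + (x,y)` (with `|(x,y)|` tiny). Using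
> Lemma 47 and letting `n` tend to infinity gives
> `lim_n Ψ₂(u₁,u₁',u₂,u₂') = ∫ e^{-as} (e^{-ax-iby} - 1) dμ(a,b)`. Using Lemma 38 (ii) […]
> `I_F(|se₁+(x,y)|) - I_F(|se₁|) = ∫ e^{-as} (e^{-ax-iby} - 1) dμ(a,b)` (eq:last_identity).
> Now, calculating the Laplacian in `(x,y)` at the point `(0,0)` yields
> `ΔI_F(|u|)|_{u=se₁} = ∫ (a²-b²) e^{-as} dμ(a,b)` (eq:identifying Delta I). We used that we may
> differentiate under the integral thanks to the dominated convergence theorem, using that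
> `a ∧ 1/a` is integrable, and that `|b| ≤ a` (Theorem 40).

For `μ ∈ 𝓜_{c,C}` with `|b| ≤ a` `μ`-a.e. (Theorem 40) we derive from the **vertical case `x = 0`
of eq. (last_identity)** (real parts; `I_F` is real and the imaginary part of the right-hand side
vanishes by the reflection symmetry of `μ`),
`I_F(√(s²+y²)) - I_F(s) = ∫ e^{-as} (cos(by) - 1) dμ(a,b)`,
its second-order consequence at `y = 0` — the `∂_{yy}`-component of eq. (identifying Delta I):
**`F(s,0) = s ∫ b² e^{-as} dμ(a,b)`** (`dklmF_re_eq_of_lastIdentity`). Both sides of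
eq. (last_identity) vanish to first order in `y`; we compare the limits of their quotients by `y²`:
`(I_F(r(y)) - I_F(s))/y² → I_F'(s)/(2s) = -F(s,0)/(2s)` (`r(y) = √(s²+y²)`, `I_F' = -F(·,0)`) and
`y⁻² ∫ e^{-as}(cos(by) - 1) dμ → -½ ∫ b² e^{-as} dμ` (dominated convergence, `1 - cos t ≤ t²/2`,
`b² ≤ a²`).

* `integrable_sq_mul_exp`, `integrable_sq_snd_mul_exp` (`a² e^{-as}`, `b² e^{-as}` are integrable);
* `tendsto_cos_sub_one_div_sq` (`(cos(by)-1)/y² → -b²/2`), `abs_cos_sub_one_div_sq_le`;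
* `tendsto_integral_cos_sub_one_div_sq` (the right-hand side), `tendsto_dklmIF_sqrt_sub_div_sq`
  (the left-hand side), **`dklmF_re_eq_of_lastIdentity`**.

## References

* H. Duminil-Copin, K. K. Kozlowski, P. Lammers, I. Manolescu, arXiv:2603.06268 (2026), Part II,
  proof of Theorem 46, eq. (last_identity) and (identifying Delta I). [DKLM2026SixVertexGFF]
-/

noncomputable section

open MeasureTheory Set Filter Topology

namespace Literature.Probability.LatticeModels.SixVertex

variable {c C : ℝ} {μ : Measure (ℝ × ℝ)}

/-! ## 1. Integrability of `a² e^{-as}` and `b² e^{-as}` -/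

/-- `a² e^{-as}` is `μ`-integrable for `μ ∈ 𝓜`, `s > 0`. [cite: DKLM2026SixVertexGFF, Part II, proof of Lemma 37] -/
theorem integrable_sq_mul_exp (h : μ ∈ dklmSpaceM c C) {s : ℝ} (hs : 0 < s) :
    Integrable (fun p : ℝ × ℝ => p.1 ^ 2 * Real.exp (-(p.1 * s))) μ := by
  refine dklmSpaceM_integrable h (K := max 1 (6 / s ^ 3)) (Continuous.continuousOn (by fun_prop)) (by positivity)
    fun p hp => ?_
  rw [Real.norm_eq_abs, abs_of_nonneg (by positivity)]
  exact sq_mul_exp_neg_le_min_inv hp hs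

/-- `b² e^{-as}` is `μ`-integrable once `|b| ≤ a` `μ`-a.e. (Theorem 40).
[cite: DKLM2026SixVertexGFF, Part II, proof of Theorem 46] -/
theorem integrable_sq_snd_mul_exp (h : μ ∈ dklmSpaceM c C) (hab : ∀ᵐ p ∂μ, |p.2| ≤ p.1) {s : ℝ} (hs : 0 < s) :
    Integrable (fun p : ℝ × ℝ => p.2 ^ 2 * Real.exp (-(p.1 * s))) μ := by
  refine (integrable_sq_mul_exp h hs).mono' (Continuous.aestronglyMeasurable (by fun_prop)) ?_
  filter_upwards [hab] with p hp
  rw [Real.norm_eq_abs, abs_of_nonneg (by positivity)]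
  have : p.2 ^ 2 ≤ p.1 ^ 2 := by nlinarith [abs_nonneg p.2, sq_abs p.2]
  gcongr

/-! ## 2. `(cos(by) - 1)/y² → -b²/2` with the uniform bound `b²/2` -/

/-- `|cos t - 1| ≤ t²/2`. [folklore] -/
theorem abs_cos_sub_one_le (t : ℝ) : |Real.cos t - 1| ≤ t ^ 2 / 2 := by
  rw [abs_sub_comm, abs_of_nonneg (by linarith [Real.cos_le_one t])]
  linarith [Real.one_sub_sq_div_two_le_cos (x := t)]

/-- `|(cos(by) - 1)/y²| ≤ b²/2`. [folklore] -/
theorem abs_cos_sub_one_div_sq_le (b y : ℝ) : |(Real.cos (b * y) - 1) / y ^ 2| ≤ b ^ 2 / 2 := by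
  rcases eq_or_ne y 0 with hy | hy
  · rw [hy]; simp; positivity
  · rw [abs_div, abs_of_pos (by positivity : 0 < y ^ 2), div_le_iff₀ (by positivity)]
    calc |Real.cos (b * y) - 1| ≤ (b * y) ^ 2 / 2 := abs_cos_sub_one_le _
      _ = b ^ 2 / 2 * y ^ 2 := by ring

/-- `(cos(by) - 1)/y² → -b²/2` as `y → 0`, `y ≠ 0` (`|cos t - (1 - t²/2)| ≤ (5/96) t⁴`). [folklore] -/
theorem tendsto_cos_sub_one_div_sq (b : ℝ) :
    Tendsto (fun y : ℝ => (Real.cos (b * y) - 1) / y ^ 2) (𝓝[≠] 0) (𝓝 (-(b ^ 2 / 2))) := by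
  -- `|(cos(by)-1)/y² + b²/2| ≤ (5/96) b⁴ y²` for `|by| ≤ 1`, `y ≠ 0`
  have hbound : ∀ y : ℝ, y ≠ 0 → |b * y| ≤ 1 →
      ‖(Real.cos (b * y) - 1) / y ^ 2 - (-(b ^ 2 / 2))‖ ≤ 5 / 96 * b ^ 4 * y ^ 2 := by
    intro y hy hby
    have hc := Real.cos_bound hby
    have hy2 : 0 < y ^ 2 := by positivity
    rw [Real.norm_eq_abs, show (Real.cos (b * y) - 1) / y ^ 2 - (-(b ^ 2 / 2)) =
      (Real.cos (b * y) - (1 - (b * y) ^ 2 / 2)) / y ^ 2 by field_simp; ring, abs_div, abs_of_pos hy2,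
      div_le_iff₀ hy2]
    calc |Real.cos (b * y) - (1 - (b * y) ^ 2 / 2)| ≤ |b * y| ^ 4 * (5 / 96) := hc
      _ = 5 / 96 * b ^ 4 * y ^ 2 * y ^ 2 := by
          rw [show |b * y| ^ 4 = (|b * y| ^ 2) ^ 2 by ring, sq_abs]; ring
  have hev : ∀ᶠ y in 𝓝[≠] (0 : ℝ), ‖(Real.cos (b * y) - 1) / y ^ 2 - (-(b ^ 2 / 2))‖ ≤ 5 / 96 * b ^ 4 * y ^ 2 := by
    have h1 : ∀ᶠ y in 𝓝 (0 : ℝ), |b * y| ≤ 1 := by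
      have hc : Tendsto (fun y : ℝ => |b * y|) (𝓝 0) (𝓝 0) := by
        have := (continuous_abs.comp (continuous_const.mul continuous_id) : Continuous fun y : ℝ => |b * y|).tendsto 0
        rw [Function.comp_def] at this
        convert this using 2
        simp
      exact hc.eventually (eventually_le_nhds one_pos)
    filter_upwards [h1.filter_mono nhdsWithin_le_nhds, self_mem_nhdsWithin] with y hy hy0
    exact hbound y hy0 hy
  have hlim : Tendsto (fun y : ℝ => 5 / 96 * b ^ 4 * y ^ 2) (𝓝[≠] 0) (𝓝 0) := by
    have h0 : Tendsto (fun y : ℝ => y ^ 2) (𝓝 0) (𝓝 0) := by simpa using (continuous_pow 2).tendsto (0 : ℝ)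
    have := h0.const_mul (5 / 96 * b ^ 4)
    rw [mul_zero] at this
    exact this.mono_left nhdsWithin_le_nhds
  exact tendsto_sub_nhds_zero_iff.1 (squeeze_zero_norm' hev hlim)

/-! ## 3. The two sides of eq. (last_identity) divided by `y²` -/

/-- **Right-hand side**: `y⁻² ∫ e^{-as}(cos(by) - 1) dμ → -½ ∫ b² e^{-as} dμ` as `y → 0`
(dominated convergence: `|(cos(by)-1)/y²| ≤ b²/2 ≤ a²/2` and `a² e^{-as}` is integrable).
[cite: DKLM2026SixVertexGFF, Part II, proof of Theorem 46 ("we may differentiate under the integral")] -/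
theorem tendsto_integral_cos_sub_one_div_sq (h : μ ∈ dklmSpaceM c C) (hab : ∀ᵐ p ∂μ, |p.2| ≤ p.1) {s : ℝ}
    (hs : 0 < s) :
    Tendsto (fun y : ℝ => (∫ p, Real.exp (-(p.1 * s)) * (Real.cos (p.2 * y) - 1) ∂μ) / y ^ 2) (𝓝[≠] 0)
      (𝓝 (-(1 / 2) * ∫ p, p.2 ^ 2 * Real.exp (-(p.1 * s)) ∂μ)) := by
  have heq : ∀ y : ℝ, (∫ p, Real.exp (-(p.1 * s)) * (Real.cos (p.2 * y) - 1) ∂μ) / y ^ 2 =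
      ∫ p, Real.exp (-(p.1 * s)) * ((Real.cos (p.2 * y) - 1) / y ^ 2) ∂μ := by
    intro y
    rw [← integral_div]
    refine integral_congr_ae (Eventually.of_forall fun p => ?_)
    ring
  simp_rw [heq]
  have hlimval : -(1 / 2) * ∫ p, p.2 ^ 2 * Real.exp (-(p.1 * s)) ∂μ =
      ∫ p, Real.exp (-(p.1 * s)) * (-(p.2 ^ 2 / 2)) ∂μ := by
    rw [← integral_const_mul]
    refine integral_congr_ae (Eventually.of_forall fun p => ?_)
    ring
  rw [hlimval]
  refine tendsto_integral_filter_of_dominated_convergence (fun p => Real.exp (-(p.1 * s)) * (p.1 ^ 2 / 2)) ?_ ?_ ?_ ?_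
  · exact Eventually.of_forall fun y => Continuous.aestronglyMeasurable (by fun_prop)
  · refine Eventually.of_forall fun y => ?_
    filter_upwards [hab] with p hp
    rw [Real.norm_eq_abs, abs_mul, abs_of_pos (Real.exp_pos _)]
    refine mul_le_mul_of_nonneg_left ?_ (Real.exp_pos _).le
    calc |(Real.cos (p.2 * y) - 1) / y ^ 2| ≤ p.2 ^ 2 / 2 := abs_cos_sub_one_div_sq_le _ _
      _ ≤ p.1 ^ 2 / 2 := by nlinarith [abs_nonneg p.2, sq_abs p.2]
  · refine ((integrable_sq_mul_exp h hs).div_const 2).congr (Eventually.of_forall fun p => ?_)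
    simp only
    ring
  · exact Eventually.of_forall fun p => (tendsto_cos_sub_one_div_sq p.2).const_mul _

/-- **Left-hand side**: `(I_F(√(s²+y²)) - I_F(s))/y² → I_F'(s)/(2s) = -F(s,0)/(2s)` as `y → 0`
(`I_F' = -F(·,0)` and `(√(s²+y²) - s)/y² = 1/(√(s²+y²) + s) → 1/(2s)`).
[cite: DKLM2026SixVertexGFF, Part II, proof of Theorem 46 (`∂_x I_F(|u|) = s ∂_{yy} I_F(|u|)` at `u = se₁`)] -/
theorem tendsto_dklmIF_sqrt_sub_div_sq (h : μ ∈ dklmSpaceM c C) {s : ℝ} (hs : 0 < s) :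
    Tendsto (fun y : ℝ => (dklmIF μ (Real.sqrt (s ^ 2 + y ^ 2)) - dklmIF μ s) / y ^ 2) (𝓝[≠] 0)
      (𝓝 (-(dklmF μ s 0).re / (2 * s))) := by
  set r : ℝ → ℝ := fun y => Real.sqrt (s ^ 2 + y ^ 2) with hr
  have hrc : Continuous r := by rw [hr]; fun_prop
  have hr0 : r 0 = s := by simp [hr, Real.sqrt_sq hs.le]
  have hr_gt : ∀ y : ℝ, y ≠ 0 → s < r y := by
    intro y hy
    have hy2 : 0 < y ^ 2 := by positivity
    have h' := Real.sqrt_lt_sqrt (sq_nonneg s) (show s ^ 2 < s ^ 2 + y ^ 2 by linarith)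
    rwa [Real.sqrt_sq hs.le] at h'
  have hr_nn : ∀ y, 0 ≤ r y := fun y => Real.sqrt_nonneg _
  have hr_tend : Tendsto r (𝓝[≠] 0) (𝓝[≠] s) := by
    refine tendsto_nhdsWithin_iff.2 ⟨?_, ?_⟩
    · have := hrc.tendsto 0
      rw [hr0] at this
      exact this.mono_left nhdsWithin_le_nhds
    · filter_upwards [self_mem_nhdsWithin] with y hy
      exact (hr_gt y hy).ne'
  -- the difference quotient of `I_F` at `s`
  have hslope : Tendsto (slope (dklmIF μ) s) (𝓝[≠] s) (𝓝 (-(dklmF μ s 0).re)) :=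
    hasDerivAt_iff_tendsto_slope.1 (hasDerivAt_dklmIF h hs)
  have h1 : Tendsto (fun y => slope (dklmIF μ) s (r y)) (𝓝[≠] 0) (𝓝 (-(dklmF μ s 0).re)) := hslope.comp hr_tend
  -- `(r y - s)/y² = 1/(r y + s) → 1/(2s)`
  have h2 : Tendsto (fun y => (r y - s) / y ^ 2) (𝓝[≠] 0) (𝓝 (1 / (2 * s))) := by
    have hcont : Tendsto (fun y => 1 / (r y + s)) (𝓝 0) (𝓝 (1 / (r 0 + s))) :=
      tendsto_const_nhds.div ((hrc.tendsto 0).add tendsto_const_nhds) (by rw [hr0]; positivity)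
    rw [hr0, ← two_mul] at hcont
    refine (hcont.mono_left nhdsWithin_le_nhds).congr' ?_
    filter_upwards [self_mem_nhdsWithin] with y hy
    have hy' : y ≠ 0 := hy
    have hsq : r y ^ 2 = s ^ 2 + y ^ 2 := Real.sq_sqrt (by positivity)
    have hpos : 0 < r y + s := by linarith [hr_nn y]
    rw [div_eq_div_iff hpos.ne' (pow_ne_zero 2 hy'), one_mul]
    linear_combination (-1 : ℝ) * hsq
  have h3 := h1.mul h2
  rw [show -(dklmF μ (s : ℂ) 0).re * (1 / (2 * s)) = -(dklmF μ s 0).re / (2 * s) by ring] at h3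
  refine h3.congr' ?_
  filter_upwards [self_mem_nhdsWithin] with y hy
  rw [slope_def_field]
  have hne : r y - s ≠ 0 := sub_ne_zero.2 (hr_gt y hy).ne'
  have hy2 : y ^ 2 ≠ 0 := pow_ne_zero 2 hy
  rw [div_mul_div_comm, mul_comm (r y - s) (y ^ 2), ← div_mul_div_comm, div_self hne, mul_one]

/-- **eq. (last_identity) ⇒ the `∂_{yy}`-component of eq. (identifying Delta I)**: for `μ ∈ 𝓜_{c,C}`
with `|b| ≤ a` a.e. (Theorem 40), the vertical case of eq. (last_identity),
`I_F(√(s²+y²)) - I_F(s) = ∫ e^{-as}(cos(by) - 1) dμ` (`s > 0`, `y ∈ ℝ`), forces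
**`F(s,0) = s ∫ b² e^{-as} dμ(a,b)`** for every `s > 0`.
[cite: DKLM2026SixVertexGFF, Part II, proof of Theorem 46, eq. (last_identity) ⇒ (identifying Delta I)] -/
theorem dklmF_re_eq_of_lastIdentity (h : μ ∈ dklmSpaceM c C) (hab : ∀ᵐ p ∂μ, |p.2| ≤ p.1)
    (hlast0 : ∀ s : ℝ, 0 < s → ∀ y : ℝ,
      dklmIF μ (Real.sqrt (s ^ 2 + y ^ 2)) - dklmIF μ s = ∫ p, Real.exp (-(p.1 * s)) * (Real.cos (p.2 * y) - 1) ∂μ)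
    {s : ℝ} (hs : 0 < s) : (dklmF μ s 0).re = s * ∫ p, p.2 ^ 2 * Real.exp (-(p.1 * s)) ∂μ := by
  have hL := tendsto_dklmIF_sqrt_sub_div_sq h hs
  have hR := tendsto_integral_cos_sub_one_div_sq h hab hs
  have heq : (fun y : ℝ => (dklmIF μ (Real.sqrt (s ^ 2 + y ^ 2)) - dklmIF μ s) / y ^ 2) =
      fun y => (∫ p, Real.exp (-(p.1 * s)) * (Real.cos (p.2 * y) - 1) ∂μ) / y ^ 2 := by
    funext y; rw [hlast0 s hs y]
  rw [heq] at hL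
  have huniq := tendsto_nhds_unique hL hR
  rw [div_eq_iff (by positivity : (2 * s : ℝ) ≠ 0)] at huniq
  linarith

end Literature.Probability.LatticeModels.SixVertex

end
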